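import Summits.Ventures.PercRepro.RankLevelSetHallLostHall

/-!
# PercRepro — THE FRACTIONAL LOST-SET MATCHING GIVES THE UP-HALL FORM AT THE TIGHT LAYER (p4, gen 33; C-044, UP form;
paper proofs/P4-CELL-THREE.md §14.20)

RankLevelSetHallLostInj transfers an INJECTION of the lost sets into the big `Y`-sets; RankLevelSetHallLostHall the Hall
condition.  THIS FILE transfers any FRACTIONAL matching: weights `v S T ≥ 0` supported on lost `S ⊆ T ∈ bigY`, every lost
set receiving at least `1` over the big `Y`-sets, every big `Y`-set loaded at most `1` over the lost sets
(`LostFrac M p q`, a `Prop`, NOT asserted).  The member-level weight is Rule L's LYM split on the middle levels, and on a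
big `T` every lost `S ⊆ T` passes `v S T / C(#S, q)` to each member inside it (`lostFracWeight`): loads `≤ 1`
(`lostFracWeight_load_le_one`: a lost `S` contains at most `C(#S, q)` members, night-1's `ncard_members_subset_le_choose`),
receipts `≥ Φ(p,q)` (`lostFracWeight_recv_ge_phiK`: `Φ − δ(Z)` from the middle levels by `ruleLMid_eq`, and each lost set
through `Z` returns at least its LYM weight `1/C(#S, q)` — `sum_lost_through_eq_lymDefect`).  An injection is the
`0/1` case; a RULE at the lost-set level (a big set splitting its unit among its lost subsets by any recipe with receipts
`≥ 1`) is certified here directly, without Hall's theorem.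
* `LostFrac`, `lostFracWeight`;
* `lostFracWeight_load_le_one`, `lostFracWeight_recv_ge_phiK`;
* **`hallUp_of_ncard_eq_of_lostFrac`** — `#E = p + q`, `q < p`, `LostFrac M p q` ⇒ `Φ(p,q)·#𝒜 ≤ #upNbhd(𝒜)` for every family;
* `lostFrac_of_lostInj` — an injection is a fractional matching.
Axioms: standard.
-/

namespace PercRepro

open Set Matroid Finset

variable {α : Type} (M : Matroid α) [M.Finite]

/-- **A fractional lost-set matching** — a `Prop`, NOT asserted: weights `v S T ≥ 0`, supported on the pairs of a lost set
`S` and a big `Y`-set `T ⊇ S`, every lost set receiving at least `1`, every big `Y`-set loaded at most `1`. -/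
def LostFrac (p q : ℕ) : Prop :=
  ∃ v : Set α → Set α → ℚ, (∀ S T, 0 ≤ v S T) ∧
    (∀ S T, v S T ≠ 0 → S ∈ lostSets M p q ∧ T ∈ bigY M p q ∧ S ⊆ T) ∧
    (∀ S ∈ lostSets M p q, 1 ≤ ∑ T ∈ (bigY_finite M p q).toFinset, v S T) ∧
    (∀ T ∈ bigY M p q, ∑ S ∈ (lostSets_finite M p q).toFinset, v S T ≤ 1)

/-- **The member-level weight of a fractional lost-set matching**: Rule L's LYM split on the middle levels (`#T < p`); on a
big set `T`, every lost `S ⊆ T` passes `v S T / C(#S, q)` to each member inside `S`. -/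
noncomputable def lostFracWeight (p q : ℕ) (v : Set α → Set α → ℚ) (Z T : Set α) : ℚ := by
  classical
  exact if T.ncard < p then ruleLWeight M p q Z T
    else ∑ S ∈ (lostSets_finite M p q).toFinset,
      (if Z ⊆ S then v S T / ((S.ncard.choose q : ℕ) : ℚ) else 0)

/-- The weights are non-negative. -/
theorem lostFracWeight_nonneg (p q : ℕ) (v : Set α → Set α → ℚ) (hv : ∀ S T, 0 ≤ v S T) (Z T : Set α) :
    0 ≤ lostFracWeight M p q v Z T := by
  classical
  unfold lostFracWeight
  split_ifs with h
  · exact ruleLWeight_nonneg M p q Z T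
  · refine Finset.sum_nonneg (fun S _ => ?_)
    split_ifs
    · exact div_nonneg (hv S T) (by positivity)
    · exact le_rfl

/-- The weights are supported on the pairs `Z ⊆ T`. -/
theorem subset_of_lostFracWeight_ne_zero (p q : ℕ) (v : Set α → Set α → ℚ)
    (hsupp : ∀ S T, v S T ≠ 0 → S ∈ lostSets M p q ∧ T ∈ bigY M p q ∧ S ⊆ T) (Z T : Set α)
    (h : lostFracWeight M p q v Z T ≠ 0) : Z ⊆ T := by
  classical
  unfold lostFracWeight at h
  split_ifs at h with hT
  · exact subset_of_ruleLWeight_ne_zero M p q Z T h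
  · obtain ⟨S, -, hne⟩ := Finset.exists_ne_zero_of_sum_ne_zero h
    by_cases hZS : Z ⊆ S
    · rw [if_pos hZS] at hne
      have hvne : v S T ≠ 0 := fun h0 => hne (by rw [h0, zero_div])
      exact hZS.trans (hsupp S T hvne).2.2
    · rw [if_neg hZS] at hne
      exact absurd rfl hne

/-- **Every `Y`-set is loaded at most `1`** (tight layer): the middle levels by night-1's `ruleLWeight_load_le_one`; a big
set `T` by its lost-set load `≤ 1`, each lost `S` spreading `v S T` over its at most `C(#S, q)` members. -/
theorem lostFracWeight_load_le_one (p q : ℕ) (hE : M.E.ncard = p + q) (v : Set α → Set α → ℚ)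
    (hv : ∀ S T, 0 ≤ v S T) (hcap : ∀ T ∈ bigY M p q, ∑ S ∈ (lostSets_finite M p q).toFinset, v S T ≤ 1)
    (T : Set α) (hT : T ∈ cellY M p q) :
    ∑ Z ∈ (cellMembers_finite M p q).toFinset, lostFracWeight M p q v Z T ≤ 1 := by
  classical
  set Mf : Finset (Set α) := (cellMembers_finite M p q).toFinset with hMf
  set Lf : Finset (Set α) := (lostSets_finite M p q).toFinset with hLf
  have hmem : ∀ Z, Z ∈ Mf ↔ Z ∈ cellMembers M p q := fun Z => by
    rw [hMf, (cellMembers_finite M p q).mem_toFinset]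
  have hmemL : ∀ S, S ∈ Lf ↔ S ∈ lostSets M p q := fun S => by
    rw [hLf, (lostSets_finite M p q).mem_toFinset]
  unfold lostFracWeight
  by_cases hsmall : T.ncard < p
  · simp only [if_pos hsmall]
    exact ruleLWeight_load_le_one M hE T hT
  · simp only [if_neg hsmall]
    rw [Finset.sum_comm]
    have hTbig : T ∈ bigY M p q := ⟨hT, not_lt.1 hsmall⟩
    -- each lost set S contributes at most v S T
    have hS : ∀ S ∈ Lf, (∑ Z ∈ Mf, if Z ⊆ S then v S T / ((S.ncard.choose q : ℕ) : ℚ) else 0) ≤ v S T := by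
      intro S hSL
      rw [hmemL] at hSL
      rw [Finset.sum_ite, Finset.sum_const_zero, add_zero, Finset.sum_const, nsmul_eq_mul]
      have hcount : (Mf.filter (fun Z => Z ⊆ S)).card ≤ S.ncard.choose q := by
        have h := ncard_members_subset_le_choose M hE hSL.1
        have heq : {Z : Set α | Z ∈ cellMembers M p q ∧ Z ⊆ S}
            = ((Mf.filter (fun Z => Z ⊆ S) : Finset (Set α)) : Set (Set α)) := by
          ext Z
          rw [Finset.coe_filter, Set.mem_setOf_eq, Set.mem_setOf_eq, hmem]
        rw [heq, ncard_coe_finset] at h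
        exact h
      have hpos : (0 : ℚ) < ((S.ncard.choose q : ℕ) : ℚ) := by
        exact_mod_cast Nat.choose_pos hSL.2.2.1.le
      calc ((Mf.filter (fun Z => Z ⊆ S)).card : ℚ) * (v S T / ((S.ncard.choose q : ℕ) : ℚ))
          ≤ ((S.ncard.choose q : ℕ) : ℚ) * (v S T / ((S.ncard.choose q : ℕ) : ℚ)) := by
            refine mul_le_mul_of_nonneg_right ?_ (div_nonneg (hv S T) hpos.le)
            exact_mod_cast hcount
        _ = v S T := by field_simp
    exact (Finset.sum_le_sum hS).trans (hcap T hTbig)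

/-- **Every member receives at least `Φ(p,q)`** (tight layer): `Φ − δ(Z)` from the middle levels and, from the big sets,
each lost set through `Z` returns at least its LYM weight `1/C(#S, q)`. -/
theorem lostFracWeight_recv_ge_phiK (p q : ℕ) (hE : M.E.ncard = p + q) (hpq : q < p) (v : Set α → Set α → ℚ)
    (hdem : ∀ S ∈ lostSets M p q, 1 ≤ ∑ T ∈ (bigY_finite M p q).toFinset, v S T)
    {Z : Set α} (hZ : Z ∈ cellMembers M p q) :
    phiK p q ≤ ∑ T ∈ (cellY_finite M p q).toFinset, lostFracWeight M p q v Z T := by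
  classical
  set Yf : Finset (Set α) := (cellY_finite M p q).toFinset with hYf
  set Lf : Finset (Set α) := (lostSets_finite M p q).toFinset with hLf
  set Bf : Finset (Set α) := (bigY_finite M p q).toFinset with hBf
  have hmemY : ∀ T, T ∈ Yf ↔ T ∈ cellY M p q := fun T => by
    rw [hYf, (cellY_finite M p q).mem_toFinset]
  have hmemL : ∀ S, S ∈ Lf ↔ S ∈ lostSets M p q := fun S => by
    rw [hLf, (lostSets_finite M p q).mem_toFinset]
  have hmemB : ∀ T, T ∈ Bf ↔ T ∈ bigY M p q := fun T => by
    rw [hBf, (bigY_finite M p q).mem_toFinset]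
  -- the big `Y`-sets are the `Y`-sets of size at least `p`
  have hBfilter : Yf.filter (fun T => ¬ T.ncard < p) = Bf := by
    ext T
    rw [Finset.mem_filter, hmemY, hmemB, not_lt]
    rfl
  -- the weight on a `Y`-set splits into the middle-level part and the big-set part
  have hsplit : ∀ T ∈ Yf, lostFracWeight M p q v Z T
      = (if Z ⊆ T ∧ T.ncard < p then 1 / ((T.ncard.choose q : ℕ) : ℚ) else 0)
        + (if ¬ T.ncard < p then
            ∑ S ∈ Lf, (if Z ⊆ S then v S T / ((S.ncard.choose q : ℕ) : ℚ) else 0) else 0) := by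
    intro T hTY
    rw [hmemY] at hTY
    unfold lostFracWeight
    by_cases hsmall : T.ncard < p
    · rw [if_pos hsmall, if_neg (not_not.2 hsmall : ¬ ¬ T.ncard < p), add_zero]
      unfold ruleLWeight
      by_cases hZT : Z ⊆ T
      · rw [if_pos ⟨hZ, hZT, hTY⟩, if_pos hsmall, if_pos ⟨hZT, hsmall⟩]
      · rw [if_neg (fun hc => hZT hc.2.1), if_neg (fun hc => hZT hc.1)]
    · rw [if_neg hsmall, if_pos hsmall, if_neg (fun hc => hsmall hc.2), zero_add]
  rw [Finset.sum_congr rfl hsplit, Finset.sum_add_distrib]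
  -- the middle levels
  have hmid : ∑ T ∈ Yf, (if Z ⊆ T ∧ T.ncard < p then 1 / ((T.ncard.choose q : ℕ) : ℚ) else 0)
      = ruleLMid M p q Z := by
    unfold ruleLMid
    rfl
  -- the big sets: each lost set through `Z` returns at least its LYM weight
  have hbig : lymDefect M p q Z ≤ ∑ T ∈ Yf, (if ¬ T.ncard < p then
        ∑ S ∈ Lf, (if Z ⊆ S then v S T / ((S.ncard.choose q : ℕ) : ℚ) else 0) else 0) := by
    rw [← Finset.sum_filter, hBfilter, Finset.sum_comm, ← sum_lost_through_eq_lymDefect M p q hE hpq hZ,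
      Finset.sum_filter]
    refine Finset.sum_le_sum (fun S hSL => ?_)
    rw [hmemL] at hSL
    by_cases hZS : Z ⊆ S
    · simp only [if_pos hZS]
      rw [← Finset.sum_div]
      have hpos : (0 : ℚ) < ((S.ncard.choose q : ℕ) : ℚ) := by
        exact_mod_cast Nat.choose_pos hSL.2.2.1.le
      rw [div_le_div_iff_of_pos_right hpos]
      exact hdem S hSL
    · simp only [if_neg hZS, Finset.sum_const_zero, le_refl]
  rw [hmid, ruleLMid_eq M p q hE hpq hZ]
  linarith

/-- **THE TRANSFER, FRACTIONAL FORM**: at the tight layer `#E = p + q` with `q < p`, a fractional lost-set matching gives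
the UP-Hall condition for every family of members. -/
theorem hallUp_of_ncard_eq_of_lostFrac (p q : ℕ) (hE : M.E.ncard = p + q) (hpq : q < p) (h : LostFrac M p q)
    (𝒜 : Set (Set α)) (h𝒜 : 𝒜 ⊆ cellMembers M p q) :
    phiK p q * (𝒜.ncard : ℚ) ≤ ((upNbhd M p q 𝒜).ncard : ℚ) := by
  obtain ⟨v, hv, hsupp, hdem, hcap⟩ := h
  exact hallUp_of_fracMatching M p q (lostFracWeight M p q v) (lostFracWeight_nonneg M p q v hv)
    (subset_of_lostFracWeight_ne_zero M p q v hsupp)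
    (fun Z hZ => lostFracWeight_recv_ge_phiK M p q hE hpq v hdem hZ)
    (lostFracWeight_load_le_one M p q hE v hv hcap) 𝒜 h𝒜

/-- An injection of the lost sets is a fractional matching (the `0/1` weights). -/
theorem lostFrac_of_lostInj (p q : ℕ) (h : LostInj M p q) : LostFrac M p q := by
  classical
  obtain ⟨φ, hφ, hinj⟩ := h
  refine ⟨fun S T => if S ∈ lostSets M p q ∧ φ S = T then 1 else 0, fun S T => ?_, fun S T hne => ?_,
    fun S hS => ?_, fun T hT => ?_⟩
  · dsimp only
    split_ifs <;> norm_num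
  · dsimp only at hne
    by_cases hc : S ∈ lostSets M p q ∧ φ S = T
    · obtain ⟨hSl, hST⟩ := hc
      obtain ⟨hφS, hsub⟩ := hφ S hSl
      rw [← hST]
      exact ⟨hSl, hφS, hsub⟩
    · rw [if_neg hc] at hne
      exact absurd rfl hne
  · dsimp only
    have hφS : φ S ∈ (bigY_finite M p q).toFinset := by
      rw [(bigY_finite M p q).mem_toFinset]
      exact (hφ S hS).1
    have hsum : (∑ T ∈ (bigY_finite M p q).toFinset, (if S ∈ lostSets M p q ∧ φ S = T then (1 : ℚ) else 0)) = 1 := by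
      rw [show (∑ T ∈ (bigY_finite M p q).toFinset, (if S ∈ lostSets M p q ∧ φ S = T then (1 : ℚ) else 0))
          = ∑ T ∈ (bigY_finite M p q).toFinset, (if φ S = T then (1 : ℚ) else 0) from
        Finset.sum_congr rfl (fun T _ => by
          by_cases hST : φ S = T
          · rw [if_pos hST, if_pos ⟨hS, hST⟩]
          · rw [if_neg hST, if_neg (fun hc => hST hc.2)]), Finset.sum_ite_eq, if_pos hφS]
    exact hsum.ge
  · dsimp only
    have hcount : ((lostSets_finite M p q).toFinset.filter (fun S => S ∈ lostSets M p q ∧ φ S = T)).card ≤ 1 := by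
      rw [Finset.card_le_one]
      intro S₁ hS₁ S₂ hS₂
      rw [Finset.mem_filter] at hS₁ hS₂
      exact hinj hS₁.2.1 hS₂.2.1 (hS₁.2.2.trans hS₂.2.2.symm)
    rw [Finset.sum_boole]
    exact_mod_cast hcount

end PercRepro
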